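import Summits.BirchSwinnertonDyer.Rank1Residual.GaloisImage.NineTowerOfTatePrime
import Summits.BirchSwinnertonDyer.Rank1Residual.GaloisImage.JWitnessTowerSurjectivity
import HarnessLib

/-!
# THE `3`-ADIC TOWER FROM surj(3) AND ONE `j`-WITNESS AT LEVEL `9`: a prime `q ≠ 3` with
# `ord_q j(E) < 0` and `9 ∤ ord_q j(E)` (cell `b2b-bsdres`, team n1011, seat p14 gen 2 — row T-b10
# 'wild tower at 3', ARM B, target T2 of `cells/n1011/skel/T-b9x-nine.md`)

HONEST FRAMING (cell `b2b-bsdres`, run/shared/lean/b2b/bsd-rank1-residual/, verbatim in every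
file): the goal of the cell is to DELETE the COMBINATION-SHAPED residual classes of the
Birch–Swinnerton-Dyer formula for ALL analytic-rank `≤ 1` elliptic curves over `ℚ` — "full BSD
formula for every rank `≤ 1` curve in class `C`" assembled STRICTLY from published theorems — so
that the rank-`≤ 1` remainder becomes exactly the CONSTRUCTION-SHAPED classes, which are TYPED
(missing-input `Prop`s), NOT attempted. This is not "finishing BSD". Team n1011 (N10 / N11):
research route; no claim beyond the stated classes; labels UNCHANGED; nothing is booked. Theorems
only (no definition, no named fact).

## What this file proves

additive-p4's `j`-witness lever `hasSurjectiveModNGaloisRep_pow_of_surj_of_jWitness`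
(`GaloisImage/JWitnessTowerSurjectivity.lean`: surj(p) ∧ a prime `q ≠ p` with `ord_q j < 0` and
`p ∤ ord_q j` ⟹ `ρ̄_{E,pⁿ}` onto ∀ `n`) is the multiplicative lever transported along a quadratic
twist; replacing the multiplicative lever by T1 of `GaloisImage/NineTowerOfTatePrime.lean`
(`towerSurj_three_of_surj_of_mult_of_not_nine_dvd`: at `p = 3` the hypothesis `3 ∤ v_ℓ(Δ_min)`
weakens to `9 ∤ v_ℓ(Δ_min)`) gives

* **T2 `towerSurj_three_of_surj_of_jWitness_nine`** — for `E/ℚ` (ANY model): `ρ̄_{E,3}` onto and a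
  prime `q ≠ 3` with `ord_q j(E) < 0` and `9 ∤ ord_q j(E)` ⟹ `ρ̄_{E,3ⁿ}` onto for every `n`
  (some quadratic twist is multiplicative at `q`, `exists_twist_mult_of_padicValRat_j_neg`; on its
  globally minimal model `V`, `ord_q Δ_min(V) = −ord_q j` and surj(3) transports, so T1 applies to
  `V`; untwist at level `3ⁿ`, `hasSurjectiveModNGaloisRep_pow_iff_of_model_twist`).  It contains
  T1 (a multiplicative `ℓ` with `9 ∤ v_ℓ(Δ_min)` is such a `q`, `ord_ℓ j = −v_ℓ(Δ_min)`) and the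
  tree's `j`-witness lever at `p = 3` (`3 ∤ ord_q j`); NEW: `ord_q j ≡ 3, 6 (mod 9)`, at a
  multiplicative OR additive potentially multiplicative `q`.
* `imageContainsSL2_three_of_surj_of_jWitness_nine` — Kato's (12.5.2) at `3`;
* `nine_dvd_padicValRat_j_of_surj_of_not_towerSurj_three` — the negative side: surj(3) ∧ tower
  fails ⟹ `9 ∣ ord_q j(E)` at EVERY prime `q ≠ 3` with `ord_q j < 0` (the Elkies signature:
  arXiv:math/0612734, image meets `1 + 3M₂(ℤ/9)` in scalars only).

Census reach (EVIDENCE, `HOME/b2b-bsdres-n1011-p14/e9/ram9_reach.json`): of the 1 772 wild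
surj(3) X4@3 `r_an = 0` cells needing a mod-`9` certificate, 568 + 63 = 631 satisfy T2's hypothesis
(cert-needed ↦ 1 141).  Nothing booked; no label change.

References: [SerreAbelianLadic1968] Ch. IV §3.4 Lemma 3, A.1.2; [SilvermanATAEC1994] V.5.3,
Ex. 5.13(b); [SilvermanAEC2009] X.5.4, VII.5.1(b); [Elkies2006] arXiv:math/0612734;
[Kato2004Asterisque] (12.5.2).
-/

noncomputable section

open scoped Classical

open WeierstrassCurve Literature.NumberTheory.EllipticCurves
  Literature.NumberTheory.EllipticCurves.Rank1Residual

namespace Summit.BirchSwinnertonDyer.Rank1Residual.GaloisImage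

variable (W : WeierstrassCurve ℚ) [W.IsElliptic]

/-- **T2. THE `3`-ADIC TOWER FROM surj(3) AND A LEVEL-`9` `j`-WITNESS.**  For `E/ℚ` (any model):
if `ρ̄_{E,3}` is onto and some prime `q ≠ 3` has `ord_q j(E) < 0` and `9 ∤ ord_q j(E)`, then
`ρ̄_{E,3ⁿ}` is onto for every `n`.  Proof: a quadratic twist `E^{(d)}` is multiplicative at `q`
(`AdditivePotMult.exists_twist_mult_of_padicValRat_j_neg`); on its globally minimal model `V`,
`v_q(Δ_min(V)) = −ord_q j(E)` (`dvd_padicValInt_minimalDiscriminantInt_iff_of_mult`, `j` a twist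
invariant) so `9 ∤ v_q(Δ_min(V))`, and `ρ̄_{V,3}` is onto (`surj_iff_of_model_twist`); T1
`towerSurj_three_of_surj_of_mult_of_not_nine_dvd` gives the tower for `V`, and
`hasSurjectiveModNGaloisRep_pow_iff_of_model_twist` untwists it.
[cite: SilvermanATAEC1994, V.5.3 and Exercise 5.13(b) (PDF p. 416)]
[cite: SerreAbelianLadic1968, Ch. IV §3.4, Lemma 3 and A.1.2] [cite: SilvermanAEC2009, X.5 Cor. 5.4, VII.5 Prop. 5.1(b)] -/
theorem towerSurj_three_of_surj_of_jWitness_nine (hsurj : W.HasSurjectiveModNGaloisRep 3)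
    (hJ : ∃ q : ℕ, q.Prime ∧ q ≠ 3 ∧ padicValRat q W.j < 0 ∧ ¬ (9 : ℤ) ∣ padicValRat q W.j)
    (n : ℕ) : W.HasSurjectiveModNGaloisRep (3 ^ n : ℕ) := by
  haveI : Fact (Nat.Prime 3) := ⟨Nat.prime_three⟩
  obtain ⟨q, hq, hq3, hneg, hndvd⟩ := hJ
  haveI : Fact q.Prime := ⟨hq⟩
  obtain ⟨d, hd0, hmultd⟩ :=
    AdditivePotMult.exists_twist_mult_of_padicValRat_j_neg (W := W) (q := q) hneg
  obtain ⟨V, _, _, C, hC⟩ := AdditivePotMult.exists_globallyMinimal_model_twist W hd0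
  have hWd : ∃ C : VariableChange ℚ, C • W.quadraticTwist d = V := ⟨C, hC⟩
  have hmultV : Mult V q := AdditivePotMult.mult_of_model_twist hd0 hmultd hWd
  have hjV : V.j = W.j := AdditivePotMult.j_of_model_twist hd0 hWd
  have h9 : ¬ 9 ∣ padicValNat q V.minimalDiscriminantInt.natAbs := by
    intro h
    apply hndvd
    have h' := (AdditivePotMult.dvd_padicValInt_minimalDiscriminantInt_iff_of_mult V q hmultV 9).mp h
    rw [hjV] at h'
    exact_mod_cast h'
  have hsurjV : Surj V 3 := (Additive.surj_iff_of_model_twist W 3 hd0 hWd).mpr hsurj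
  exact (hasSurjectiveModNGaloisRep_pow_iff_of_model_twist W 3 hd0 hWd n).mp
    (towerSurj_three_of_surj_of_mult_of_not_nine_dvd V hsurjV hq3 hmultV h9 n)

/-- **Kato's (12.5.2) at `3` from surj(3) and a level-`9` `j`-witness.**
[cite: Kato2004Asterisque, (12.5.2) in Thm. 12.5 (4) (p. 222)] -/
theorem imageContainsSL2_three_of_surj_of_jWitness_nine (hsurj : W.HasSurjectiveModNGaloisRep 3)
    (hJ : ∃ q : ℕ, q.Prime ∧ q ≠ 3 ∧ padicValRat q W.j < 0 ∧ ¬ (9 : ℤ) ∣ padicValRat q W.j) :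
    Kato2004.ImageContainsSL2 W 3 := by
  haveI : Fact (Nat.Prime 3) := ⟨Nat.prime_three⟩
  exact Kato2004.imageContainsSL2_of_forall_hasSurjectiveModNGaloisRep W 3
    (towerSurj_three_of_surj_of_jWitness_nine W hsurj hJ)

/-- **The negative side: surj(3) and a FAILING `3`-adic tower force `9 ∣ ord_q j(E)` at every prime
`q ≠ 3` with `ord_q j(E) < 0`** (contrapositive of T2) — the signature of Elkies' `9`-deficient
curves (arXiv:math/0612734), DECIDABLE from the `j`-invariant alone. [cite: Elkies2006, §1]
[cite: SerreAbelianLadic1968, Ch. IV, A.1.2] -/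
theorem nine_dvd_padicValRat_j_of_surj_of_not_towerSurj_three (hsurj : W.HasSurjectiveModNGaloisRep 3)
    (hnot : ¬ ∀ n : ℕ, W.HasSurjectiveModNGaloisRep (3 ^ n : ℕ))
    {q : ℕ} (hq : q.Prime) (hq3 : q ≠ 3) (hneg : padicValRat q W.j < 0) :
    (9 : ℤ) ∣ padicValRat q W.j := by
  by_contra h9
  exact hnot (towerSurj_three_of_surj_of_jWitness_nine W hsurj ⟨q, hq, hq3, hneg, h9⟩)

end Summit.BirchSwinnertonDyer.Rank1Residual.GaloisImage

end
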